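import Summits.QuantumFields.YangMills.Theorems.BalabanUVNodesN16HolderDefs
import HarnessLib

/-!
# Route «BalabanUVNodes», cluster K4 «SpineRates» — THE β-TWINS OF K4's CONCLUSION-FOR-ONE-STRING `RatesAt` AND OF ITS INSTANTIATION `RateInputs` WITH NODE
# N16 READ AT A HÖLDER EXPONENT `β` (`N16HolderAt R.ne3 β` for `N16At R.ne3`), AND THE K4 ∕ TOP JOINS OVER THEM, BY NAME — the definitions the plan's
# N16 PICK «R-β» (currency of record `S_N16Holder β`, window `2∕3 < β < 1` displayed) asks the K3 ₁₃ skeleton and composer to read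

Cell `pub-ymgap`, seat `pub-ymgap-dag-n16-e` (R134 acceleration seat (a), strategy s2 = BY-NAME KNIT at the record; HUMAN RULING D-0062; chair R424 venue), generation 15,
module 41 (DEFINITION LANE: 3 `def` + bookkeeping theorems, 0 `sorry`, standard axioms).  `--supports stmt-QuantumFields-20544` (K3⁷ `SpineGivenEndpointR13SepCoPH`, plan rev
24∕25, dag-lead WORDS-143).  `bears_on: R4∕N16 · out-edges N16 → N19 (K5's `Inputs` binder) · cluster K4 join`.  Over `BalabanUVNodesSpineRates` (dagwriter g75∕83 text of
record: `RatesAt` :165, `RateInputs` :218, `RateInputsAll` :221, joins :229–:272) and dag-n16-c's `BalabanUVNodesN16HolderDefs` (g3 file 11: `N16HolderAt`, `S_N16Holder`,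
`n16HolderAt_one_iff`, `n16HolderAt_of_n16At`, `s_N16Holder_one_iff`) — THE MODEL of this file.

WHY (director-ym g8 LINE №195 (4) → plan g77 [YMPLAN-G77-DELTA-COST + N16-PICK] (B), pub-ymgap INBOX l.23344, 2026-08-27T21:07Z).  The plan PICKED, under the as-printed
rule, node N16's currency of record = R-β: the Hölder-LETTER face `S_N16Holder β` with `β` a DISPLAYED letter in the window `2∕3 < β < 1` (lower edge = the N19∕N21
consumers' geometric-ratio threshold, dag-n16-c `…N16HolderWindow` `rate_base_lt_one_of_window`; upper edge = print, [Balaban1985RegularSpaces] (1.36) p. 82 «β ≦ β₀ < 1»,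
Prop. 3 p. 87).  Its ledger∕tree effect (e2) names TWO additive files: a DEFS twin — «`RatesHolderAt D R β := N14At ∧ N15At ∧ N16HolderAt R.ne3 β ∧ N17At D ∧ N18At ∧ N22At`
+ the `RateInputs RRec` binder of `S_N19 SRec (RateInputs RRec)` at β — SpineRates :165 ∕ :217 twins in ONE defs file, `N16HolderDefs` is the model» — and the ₁₃ composer twin
(dag-n27-c's pen), after which the plan re-cuts the K3 skeleton (`stub_rates13` ∕ `stub_expansion13` over `RatesHolderAt` with the window binder displayed).  THIS IS THE
DEFS TWIN.  The window binder is NOT placed inside the definitions (it is the consumer's displayed hypothesis, plan (e2) «with the window binder `2/3 < β ∧ β < 1`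
displayed, same composition shape»); `β` is a free real parameter throughout, exactly as in `N16HolderDefs`.

WHAT THIS FILE DECLARES ∕ PROVES (nothing of record edited; SpineRates and N16HolderDefs byte-untouched):
* §1 `RatesHolderAt D R β` — K4's conclusion for one string at a Hölder exponent: `RatesAt D R` (SpineRates :165) with its third conjunct `N16At R.ne3` REPLACED by
  dag-n16-c's `N16HolderAt R.ne3 β`; `ratesHolderAt_iff` (`Iff.rfl`); `ratesHolderAt_one_iff : RatesHolderAt D R 1 ↔ RatesAt D R` (by `n16HolderAt_one_iff`);
  `ratesHolderAt_of_ratesAt` (β ≤ 1, `1 ≤ R.ne3.L`, `0 ≤ R.ne3.Λ₂′`; by `n16HolderAt_of_n16At`) — the rates of record are STRONGER; `dressedStability_of_ratesHolderAt`.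
* §2 `RateInputsHolder RRec β` ∕ `RateInputsAllHolder RRec β` — the ∃- ∕ ∀-packagings (SpineRates :218 ∕ :221 twins; the binder K5's edge reads as
  `S_N19 SRec (RateInputsHolder RRec β)`); `rateInputsHolder_iff` ∕ `rateInputsAllHolder_iff` (`Iff.rfl`); `rateInputsHolder_one_iff` ∕ `rateInputsAllHolder_one_iff`
  (β = 1 IS the record's packaging, pointwise); `rateInputsHolder_of_rateInputs` (β ≤ 1 under the regime side conditions).
* §3 JOINS (kernel, SpineRates :229–:272 twins, for every `Rec`, `SRec`, `RRec`, `β`): `SpineRates_of_holder` (∃-packaging, N17 a stub; binder `h16 : S_N16Holder β RRec`),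
  `SpineRates_of_holder_glueN17`, `SpineRates_of_forall_holder`, `spineRatesHolder_exists_of_forall`, `spineRatesHolder_of_spineRates` (β ≤ 1, regime side
  conditions: the record's K4 conclusion implies the β-one), and the stub-level top joins `uvD59_of_K4K5stubs_holder` ∕ `uvD59_of_K4K5stubs_holder_glueN17`
  (`uvD59_of_clusters Rec (RateInputsHolder RRec β)`, K5's N19 edge read as `S_N19 SRec (RateInputsHolder RRec β)`; every K1–K5 stub in the term).

HONEST FRAMING.  Definitions (hypothesis∕target SHAPES asserted for no bundle) + compositions of tree theorems by name; no estimate; the window `2∕3 < β < 1` is a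
displayed binder of the consumers, not asserted here; NOTHING of Bałaban's is asserted; no node is discharged — **N16 ∕ NE3 NOT discharged** (discharge test from now,
plan (e5): a gate-accepted, referee-read proof of `S_N16Holder β (RRec₁₃CoPHOn …)` at the record for SOME displayed `β ∈ (2∕3,1)`); count-neutral (typed 28∕28 ·
discharged 5∕27, A 5∕28 UNMOVED); K0⁷ ∕ K3⁷ OPEN; one finite four-torus programme at fixed ε — NOT ℝ⁴, NOT infinite volume, NOT OS, NOT a mass gap, NOT Clay.  No `sorry`,
no `instance`, no `notation`.
-/

set_option autoImplicit false

namespace Summit.QuantumFields.YangMills.BalabanUVNodes.SpineRatesHolder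

open Literature.MathematicalPhysics.QuantumFieldTheory.Balaban1983to89
open Literature.MathematicalPhysics.QuantumFieldTheory.Balaban1983to89.T4Continuum (T4Family ULoop)
open Summit.QuantumFields.BalabanUV.T4Continuum
open Summit.QuantumFields.BalabanUV.T4Continuum.NE1p.DressedRoot (DressedStability)
open YMDAG.UVSplit
open Summit.QuantumFields.YangMills.BalabanUVNodes.N16HolderDefs (N16HolderAt S_N16Holder n16HolderAt_one_iff n16HolderAt_of_n16At)

noncomputable section

/-! ## §1 K4's conclusion for ONE string at a Hölder exponent `β` -/

section OnDatum

variable {N : ℕ} [NeZero N] {F : T4Family}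

/-- **K4's CONCLUSION FOR ONE STRING AT GIVEN CARRIERS, NODE N16 READ AT HÖLDER EXPONENT `β`** — the β-twin of `YMDAG.UVSplit.RatesAt D R` (SpineRates §7.2 :165):
the six in-edges of N19 (NE1′, NE2, NE3 at exponent `β`, NE4, NE5, NE9) with dag-n16-c's `N16HolderAt R.ne3 β` in place of `N16At R.ne3`; what K5's `Inputs` binder
unpacks under the plan's N16 PICK «R-β».  `β` = node N16's Hölder LETTER of record (plan g77 N16-PICK, pub-ymgap INBOX l.23344 (B)); print's range is
«β ≦ β₀ < 1» ([Balaban1985RegularSpaces] (1.36) p. 82, Prop. 3 p. 87); the consumers' window `2∕3 < β` (`< 1`) is DISPLAYED AT THE CONSUMER (K3 v2 skeleton ∕ ₁₃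
composer), not here — `β` is a free letter in this file.  A hypothesis∕target SHAPE, asserted for no bundle. [folklore] -/
@[folklore]
def RatesHolderAt (D : Datum F N) (R : RateCarriers N) (β : ℝ) : Prop :=
  N14At R.ne1 ∧ N15At R.ne2 ∧ N16HolderAt R.ne3 β ∧ N17At D R.u3 ∧ N18At R.u3 ∧ N22At R.u3

/-- `RatesHolderAt D R β` unfolded one step (`Iff.rfl`). [folklore] -/
theorem ratesHolderAt_iff (D : Datum F N) (R : RateCarriers N) (β : ℝ) :
    RatesHolderAt D R β ↔ N14At R.ne1 ∧ N15At R.ne2 ∧ N16HolderAt R.ne3 β ∧ N17At D R.u3 ∧ N18At R.u3 ∧ N22At R.u3 :=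
  Iff.rfl

/-- **AT `β = 1` THE TWIN IS K4's CONCLUSION OF RECORD**: `RatesHolderAt D R 1 ↔ RatesAt D R` (dag-n16-c `n16HolderAt_one_iff` on the third conjunct). [folklore] -/
theorem ratesHolderAt_one_iff (D : Datum F N) (R : RateCarriers N) : RatesHolderAt D R 1 ↔ RatesAt D R := by
  unfold RatesHolderAt RatesAt
  rw [n16HolderAt_one_iff]

/-- **THE RATES OF RECORD IMPLY THE β-RATES FOR EVERY `β ≤ 1`** (block factor `1 ≤ R.ne3.L`, Hölder letter `0 ≤ R.ne3.Λ₂′` — both hold in THE END's regime of record;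
dag-n16-c `n16HolderAt_of_n16At`): R-β asks LESS of node N05's socket than the decl of record. [folklore] -/
theorem ratesHolderAt_of_ratesAt {D : Datum F N} {R : RateCarriers N} (h : RatesAt D R) (hL : 1 ≤ R.ne3.L) {β : ℝ} (hβ : β ≤ 1) (hΛ : 0 ≤ R.ne3.Λ₂') :
    RatesHolderAt D R β :=
  ⟨h.1, h.2.1, n16HolderAt_of_n16At h.2.2.1 hL hβ hΛ, h.2.2.2.1, h.2.2.2.2.1, h.2.2.2.2.2⟩

/-- Bookkeeping (kernel): the weak dressed-stability headline at any carriers carrying the β-rates (`dressedStability_of_strict`, as for `RatesAt`). [folklore] -/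
theorem dressedStability_of_ratesHolderAt {D : Datum F N} {R : RateCarriers N} {β : ℝ} (h : RatesHolderAt D R β) : DressedStability R.ne1.𝒯 :=
  NE1p.DressedRoot.dressedStability_of_strict h.1

end OnDatum

/-! ## §2 The instantiations of K5's `Inputs` parameter at exponent `β` (∃- and ∀-packaging) -/

section Split

variable {N : ℕ} [NeZero N] (Rec : RecordPred N) (SRec : SpineRecordPred N) (RRec : RateRecordPred N)

/-- **`RateInputsHolder RRec β`** — the β-twin of `YMDAG.UVSplit.RateInputs RRec` (SpineRates §7.4 :218, ∃-packaging): some rate carriers of record for `(D, g₀, os)` carry the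
six in-edges of N19 with node N16 read at exponent `β`.  Under the N16 PICK «R-β», K4 := `SpineRates Rec (RateInputsHolder RRec β)` and K5's edge reads
`S_N19 SRec (RateInputsHolder RRec β)`, `β` displayed with its window.  A SHAPE, asserted for no record. [folklore] -/
@[folklore]
def RateInputsHolder (β : ℝ) : InputsPred N := fun F D g₀ os => ∃ R : RateCarriers N, RRec F D g₀ os R ∧ RatesHolderAt D R β

/-- **`RateInputsAllHolder RRec β`** — the β-twin of `YMDAG.UVSplit.RateInputsAll RRec` (:221, ∀-packaging): every rate carrier of record carries the six in-edges with N16 at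
exponent `β`. [folklore] -/
@[folklore]
def RateInputsAllHolder (β : ℝ) : InputsPred N := fun F D g₀ os => ∀ R : RateCarriers N, RRec F D g₀ os R → RatesHolderAt D R β

variable {Rec SRec RRec}

/-- What N19's prover unpacks from `RateInputsHolder RRec β` (`Iff.rfl`). [folklore] -/
theorem rateInputsHolder_iff (β : ℝ) {F : T4Family} (D : Datum F N) (g₀ : ℕ → ℝ) (os : List (ULoop F)) :
    RateInputsHolder RRec β F D g₀ os ↔ ∃ R : RateCarriers N, RRec F D g₀ os R ∧ RatesHolderAt D R β :=
  Iff.rfl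

/-- `RateInputsAllHolder RRec β` unfolded (`Iff.rfl`). [folklore] -/
theorem rateInputsAllHolder_iff (β : ℝ) {F : T4Family} (D : Datum F N) (g₀ : ℕ → ℝ) (os : List (ULoop F)) :
    RateInputsAllHolder RRec β F D g₀ os ↔ ∀ R : RateCarriers N, RRec F D g₀ os R → RatesHolderAt D R β :=
  Iff.rfl

/-- **AT `β = 1` THE ∃-PACKAGING IS THE RECORD's** (pointwise): `RateInputsHolder RRec 1 F D g₀ os ↔ RateInputs RRec F D g₀ os`. [folklore] -/
theorem rateInputsHolder_one_iff {F : T4Family} (D : Datum F N) (g₀ : ℕ → ℝ) (os : List (ULoop F)) :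
    RateInputsHolder RRec 1 F D g₀ os ↔ RateInputs RRec F D g₀ os := by
  simp only [rateInputsHolder_iff, rateInputs_iff, ratesHolderAt_one_iff]

/-- **AT `β = 1` THE ∀-PACKAGING IS THE RECORD's** (pointwise). [folklore] -/
theorem rateInputsAllHolder_one_iff {F : T4Family} (D : Datum F N) (g₀ : ℕ → ℝ) (os : List (ULoop F)) :
    RateInputsAllHolder RRec 1 F D g₀ os ↔ RateInputsAll RRec F D g₀ os := by
  simp only [rateInputsAllHolder_iff, RateInputsAll, ratesHolderAt_one_iff]

/-- **THE RECORD's ∃-PACKAGING IMPLIES THE β-ONE FOR `β ≤ 1`**, given the regime side conditions on the record's NE3 carriers (`1 ≤ L`, `0 ≤ Λ₂′`). [folklore] -/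
theorem rateInputsHolder_of_rateInputs {β : ℝ} (hβ : β ≤ 1)
    (hreg : ∀ (F : T4Family) (D : Datum F N) (g₀ : ℕ → ℝ) (os : List (ULoop F)) (R : RateCarriers N), RRec F D g₀ os R → 1 ≤ R.ne3.L ∧ 0 ≤ R.ne3.Λ₂')
    {F : T4Family} {D : Datum F N} {g₀ : ℕ → ℝ} {os : List (ULoop F)} (h : RateInputs RRec F D g₀ os) :
    RateInputsHolder RRec β F D g₀ os := by
  obtain ⟨R, hR, hAt⟩ := h
  exact ⟨R, hR, ratesHolderAt_of_ratesAt hAt (hreg F D g₀ os R hR).1 hβ (hreg F D g₀ os R hR).2⟩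

/-! ## §3 The K4 joins and the stub-level top joins at exponent `β` (kernel; SpineRates §7.4 twins) -/

variable (Rec SRec RRec)

/-- **K4 JOIN AT EXPONENT `β`, ∃-packaging, N17 a stub (kernel)** — `SpineRates_of` (SpineRates :229) with `h16 : S_N16Holder β RRec` (dag-n16-c) in place of `S_N16 RRec`:
existence of the carriers of record under the pins (R00x) with the six by-name estimates at them IS K4's β-conclusion hook (`ForSmallCouplings.mono`). [folklore] -/
theorem SpineRates_of_holder {β : ℝ} (hx : S_R00x Rec RRec) (h14 : S_N14 RRec) (h15 : S_N15 RRec) (h16 : S_N16Holder β RRec) (h17 : S_N17 RRec)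
    (h18 : S_N18 RRec) (h22 : S_N22 RRec) : SpineRates Rec (RateInputsHolder RRec β) := by
  intro F D w hR hB hEnd
  refine (hx F D w hR hB hEnd).mono fun g₀ hg os => ?_
  obtain ⟨R, hRR⟩ := hg os
  exact ⟨R, hRR, h14 F D g₀ os R hRR, h15 F D g₀ os R hRR, h16 F D g₀ os R hRR, h17 F D g₀ os R hRR, h18 F D g₀ os R hRR,
    h22 F D g₀ os R hRR⟩

/-- **K4 JOIN AT EXPONENT `β`, N17 GLUED and (D4) a stub (kernel)** — seven binders R00x, N14, N15, N16-Hölder, N18, N22, D4 (`N17_of_U3edge` by name). [folklore] -/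
theorem SpineRates_of_holder_glueN17 {β : ℝ} (hx : S_R00x Rec RRec) (h14 : S_N14 RRec) (h15 : S_N15 RRec) (h16 : S_N16Holder β RRec)
    (h18 : S_N18 RRec) (h22 : S_N22 RRec) (hD4 : S_D4 RRec) : SpineRates Rec (RateInputsHolder RRec β) :=
  SpineRates_of_holder Rec RRec hx h14 h15 h16 (N17_of_U3edge RRec hD4 h18 h22) h18 h22

/-- **K4 JOIN AT EXPONENT `β`, ∀-packaging (kernel)**: the six by-name estimates alone give the hook at `RateInputsAllHolder` (`ForSmallCouplings.of_forall`). [folklore] -/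
theorem SpineRates_of_forall_holder {β : ℝ} (h14 : S_N14 RRec) (h15 : S_N15 RRec) (h16 : S_N16Holder β RRec) (h17 : S_N17 RRec) (h18 : S_N18 RRec)
    (h22 : S_N22 RRec) : SpineRates Rec (RateInputsAllHolder RRec β) := by
  intro F D w _ _ _
  exact T4ContinuumYM4Torus.ForSmallCouplings.of_forall fun g₀ os R hRR =>
    ⟨h14 F D g₀ os R hRR, h15 F D g₀ os R hRR, h16 F D g₀ os R hRR, h17 F D g₀ os R hRR, h18 F D g₀ os R hRR, h22 F D g₀ os R hRR⟩

/-- Bookkeeping (kernel): under existence, the ∀-packaged β-hook gives the ∃-packaged one (`ForSmallCouplings.and` + `mono`). [folklore] -/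
theorem spineRatesHolder_exists_of_forall {β : ℝ} (hx : S_R00x Rec RRec) (h : SpineRates Rec (RateInputsAllHolder RRec β)) :
    SpineRates Rec (RateInputsHolder RRec β) := by
  intro F D w hR hB hEnd
  exact ((hx F D w hR hB hEnd).and (h F D w hR hB hEnd)).mono fun g₀ hg os => by
    obtain ⟨R, hRR⟩ := hg.1 os
    exact ⟨R, hRR, hg.2 os R hRR⟩

/-- **THE RECORD's K4 HOOK IMPLIES THE β-HOOK FOR `β ≤ 1`** (kernel; regime side conditions on the record's NE3 carriers; `ForSmallCouplings.mono` with
`rateInputsHolder_of_rateInputs`) — the PICK weakens K4's conclusion, it does not strengthen it. [folklore] -/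
theorem spineRatesHolder_of_spineRates {β : ℝ} (hβ : β ≤ 1)
    (hreg : ∀ (F : T4Family) (D : Datum F N) (g₀ : ℕ → ℝ) (os : List (ULoop F)) (R : RateCarriers N), RRec F D g₀ os R → 1 ≤ R.ne3.L ∧ 0 ≤ R.ne3.Λ₂')
    (h : SpineRates Rec (RateInputs RRec)) : SpineRates Rec (RateInputsHolder RRec β) := by
  intro F D w hR hB hEnd
  exact (h F D w hR hB hEnd).mono fun g₀ hg os => rateInputsHolder_of_rateInputs hβ hreg (hg os)

/-- **`uvD59_of_K4K5stubs_holder` — THE TOP JOIN AT STUB LEVEL FOR K4 AND K5 AT EXPONENT `β` (kernel)**: `uvD59_of_K4K5stubs` (SpineRates :258) with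
`h16 : S_N16Holder β RRec` and K5's N19 edge read as `S_N19 SRec (RateInputsHolder RRec β)`; K1 → K2 → K3 → the seven K4 β-stubs → the five K5 stubs → `UVD59 N`
(`uvD59_of_clusters Rec (RateInputsHolder RRec β)`), every K4∕K5 stub in the term, for EVERY `Rec`, `SRec`, `RRec`, `β`. [folklore] -/
theorem uvD59_of_K4K5stubs_holder {β : ℝ} (h1 : KnitIR Rec) (h2 : FlowBounds Rec) (h3 : RenormalisationBeta Rec)
    (hx : S_R00x Rec RRec) (h14 : S_N14 RRec) (h15 : S_N15 RRec) (h16 : S_N16Holder β RRec) (h17 : S_N17 RRec) (h18 : S_N18 RRec)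
    (h22 : S_N22 RRec)
    (hx' : S_N27x Rec SRec) (h20 : S_N20 SRec) (h21 : S_N21 SRec) (h19 : S_N19 SRec (RateInputsHolder RRec β)) (hU4 : S_U4 SRec) :
    UVD59 N :=
  uvD59_of_clusters Rec (RateInputsHolder RRec β) h1 h2 h3 (SpineRates_of_holder Rec RRec hx h14 h15 h16 h17 h18 h22)
    (SpineMatching_of Rec SRec (RateInputsHolder RRec β) hx' h20 h21 h19 hU4)

/-- The same with N17 GLUED and (D4) a stub (kernel). [folklore] -/
theorem uvD59_of_K4K5stubs_holder_glueN17 {β : ℝ} (h1 : KnitIR Rec) (h2 : FlowBounds Rec) (h3 : RenormalisationBeta Rec)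
    (hx : S_R00x Rec RRec) (h14 : S_N14 RRec) (h15 : S_N15 RRec) (h16 : S_N16Holder β RRec) (h18 : S_N18 RRec) (h22 : S_N22 RRec)
    (hD4 : S_D4 RRec)
    (hx' : S_N27x Rec SRec) (h20 : S_N20 SRec) (h21 : S_N21 SRec) (h19 : S_N19 SRec (RateInputsHolder RRec β)) (hU4 : S_U4 SRec) :
    UVD59 N :=
  uvD59_of_K4K5stubs_holder Rec SRec RRec h1 h2 h3 hx h14 h15 h16 (N17_of_U3edge RRec hD4 h18 h22) h18 h22 hx' h20 h21 h19 hU4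

end Split

end

end Summit.QuantumFields.YangMills.BalabanUVNodes.SpineRatesHolder
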